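/-
Copyright (c) 2026 the pub-hodgecm-mathlib formalisation cell (harness21).  Prover seat hodgecm-mathlib-K2Liu-p14 (g4), Track B «K2-LIT»,
#184♮ = hLiu418 = `stmt-HodgeConjecture-24832`; socket #41, KIND 1 (K1-b♮), organ (K1b-W) «KIND W AT `n := 1` FOR THE PULLED-BACK FAMILY»,
brick (KW1-b2) — LEAD F0P6-plan (g14) BATCH #107 (1) (dealt K2Liu-p05 (g7); line lead K2Liu-p14 takes it, WORD #4), this seat's LINE WORD #2 spec.
THEOREMS ONLY (no `def`, no `instance`, no notation, no named-fact hypothesis, no `sorry`).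
-/
import Summits.HodgeConjecture.HodgeConjecture.Theorems.K2LiuUnipDeltaRankOneHaar            -- ★ O41.5c∕d rank one: coordinates, profile, Haar transport, `integral_comp_coord`
import Summits.HodgeConjecture.HodgeConjecture.Theorems.K2LiuGKRankOneIdentityLFactor        -- ★ `prod_norm_toPlace_cpow`, `norm_rawParam_lt_of_re_pos`
import Summits.HodgeConjecture.HodgeConjecture.Theorems.K2LiuRankOneTwistedWhittakerPolynomial -- ★ W1-fin-good-II: the twisted step-weight integral `μ(𝒪)(1 − θ)Σ(θq)^k`
import Summits.HodgeConjecture.HodgeConjecture.Theorems.K2LiuSphericalSectionLambdaLoc         -- ★ (4c) `isSphericalSection_lambdaLoc` (CM frame `Λ_{s,v}` is ★ D10-spherical)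
import Summits.HodgeConjecture.HodgeConjecture.Theorems.K2LiuLocalWhittakerFactorSkew          -- ★ B4 §1 `evalPlace_finPart_weylDelta`; brings ★ B1 `unipDeltaLoc_eq_unipDeltaLocal`, `unipDeltaChar`, `locToAdelic`
import Literature.NumberTheory.Automorphic.AdicCompletionResidueCard                          -- ★ `residueFieldCard_adicCompletion_eq` (`q(F_v) = v.residueCard`)
import Literature.NumberTheory.GelbartRogawski1991.DoubledWeilRepresentationArchLagrangian    -- ★ `isUnit_det_gramR₀`
import Literature.NumberTheory.GelbartRogawski1991.LocalDoubledUnitaryGoodPlace               -- ★ `valuation_eq_one_iff_valued`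
import HarnessLib

/-!
# Crux `HLiu418`, socket #41, KIND 1 ∕ organ (K1b-W), brick (KW1-b2): THE TWISTED RANK-ONE GINDIKIN–KARPELEVICH VALUE —
# `∫_{N_Δ(F_v)} ψ_v(ξ·b(u)) · φ°(w_Δ u) dν_N(u) = ν_N(N_Δ ∩ K_v) · (1 − t)`, `t = α·P^{s+½} = α q_v^{−(2s+1)}` (unit `ξ`, conductor `𝒪_v`)

Cell `hodgecm-mathlib`, crux item hLiu418 = `stmt-HodgeConjecture-24832` (helper lane `--supports … --as helper`, count-neutral), route of record
`HCCMUnconditional`; squad K2 ∕ K2Liu, road `K2_Liu`, socket #41 `sig_K2LiuSiegelEisensteinContinuation`, KIND 1, organ (K1b-W) (line lead K2Liu-p14 (g4)).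
THE LETTER PAID.  ★ p862675 (KW1-b) `K2LiuKindOneLineWhittakerEuler.whittakerDelta_eq_kindWPart_mul_line` takes, at every place `v ∉ U(μ,x)`, the RANK-ONE good-place
letter `hJ₁ : ∫ conj ψ_μ(ι_v y)·Λ⁽¹⁾_{s,v}((w_Δ)_v y) dν_v(y) = 1 − ε_v(ϖ_v) q_v^{−(2s+1)}` BY VALUE.  Its mathematics is the `U(1,1)` unramified computation
`∫_{F_v} φ°(w₁ n(ι_v b δ)) ψ_v(ξ b) db` for a UNIT `ξ` and `ψ_v` of conductor `𝒪_v`: `φ° = 1` on `|b| ≤ 1`, `= t^{m+1}` on the shell `|b| = q^{m+1}`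
(★ `apply_weylDelta_mul_nElem_coord_of_le_one`, ★ `localSiegelCharacter_profile` — the Iwasawa∕Tate unfolding, ALREADY ★ in the rank-one GK lineage of K2Liu-p01), and
the character kills every shell but the first (★ W1-fin-good-II `integral_stepWeight_mul_addChar_eq_closedForm_of_integrable` at conductor `0`, `n = 0`): value `μ(𝒪)(1 − t)`.
THIS FILE (GR91 local frame `F ⊂ E`, `c`, `δ`, rank `1`, `H(F_v) = U(T₀ ⊕ −T₀)(F_v)`):
* §1 **`integral_twisted_apply_weylDelta_nElem_coord`** — in the coordinate `b`: for a spherical section `φ°` of `I_v(s, χ_v)` (★ D10), `|2|_w = |δ|_w = 1`, `χ_w`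
  unramified, a uniformizer `ϖ`, `‖t‖ < q_v⁻¹`, an additive Haar `μ` on `F_v`, `ψ` continuous of conductor exponent `0` and `|ξ|_v = 1`:
  `∫ φ°(w_Δ n(ι_v b δ)) · ψ(b ξ) dμ(b) = μ(𝒪_v) · (1 − t)` (+ integrability of the twisted integrand).
* §2 **`integral_twist_mul_apply_weylDelta_eq`** — the `N_Δ`-form, for ANY subgroup `N′ = N_Δ(F_v)` (the `subst` pattern of ★ (F-GK-4) §1, so the K2Lit
  global-comap `unipDeltaLoc v` is served by ★ B1 `unipDeltaLoc_eq_unipDeltaLocal`): for a Haar `ν_N` on `N′` and a twist `Ψ : H(F_v) → ℂ` READ on the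
  coordinate (`Ψ(n(ι_v b δ)) = ψ(b ξ)`, by value — ★ (d1) `unipDeltaChar_locToAdelic_eq_prod` + ★ B1 `trace_mul_toBlocks₁₂_component_nElem` + Tate's `hΨ` pay it for
  `Ψ = conj ψ_μ ∘ ι_v`), `∫_{N′} Ψ(u) φ°(w_Δ u) dν_N(u) = ν_N(N′ ∩ K_v) · (1 − t)` (★ `integral_comp_coord`, ★ `isAddHaarMeasure_map_coordInv`,
  ★ `map_coordInv_primePowBall_zero`).
  `integral_twist_mul_apply_weylDelta_eq_of_re_pos` — the same with the raw parameter READ: `t = α · q_v^{−(2s+1)}` (★ `prod_norm_toPlace_cpow`), `‖t‖ < q_v⁻¹`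
  from `0 < re s` and `|α| ≤ 1` (★ `norm_rawParam_lt_of_re_pos`), and the normalisation `ν_N(N′ ∩ K_v) = 1`: value `1 − α q_v^{−(2s+1)}`.
* §3 **`integral_conj_unipDeltaChar_mul_lambdaLoc_weylDelta_eq`** — THE `hJ₁` LETTER IN ITS OWN TOKENS at the K2Lit CM datum (`L`, `e : Fin N × Fin M ≃ Fin 1`, `dV dW`):
  the subgroup `unipDeltaLoc v` (★ B1 `unipDeltaLoc_eq_unipDeltaLocal`), the section `LambdaLoc v χ s` (★ (4c) `isSphericalSection_lambdaLoc`), the global `(w_Δ)_v`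
  (★ B4 §1 `evalPlace_finPart_weylDelta`), the twist `conj ψ_S ∘ ι_v` with its coordinate reading BY VALUE, `α = ε(ϖ_v)` by the parity letter `hα` (by value,
  exactly as ★ `K2LiuGoodPlaceLocalFactor`) and `q(F_v) = v.residueCard` (★ `residueFieldCard_adicCompletion_eq`):
  `∫ conj ψ_S(ι_v y)·Λ_{s,v}((w_Δ)_v y) dν(y) = 1 − ε(ϖ_v)·q_v^{−(2s+1)}`.
[HarrisKudlaSweet1996, §6 (6.14)–(6.16)] [Casselman1980, §3] [Tate1950, §2.5] [KudlaRallis1994, §2] [Shimura1997, §18.1 (18.4)].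
HONEST LABEL.  Count-neutral helper; closes no socket by itself; `HC_CM` is proved only modulo the 7 printed citations (2 remaining named inputs:
hLiu418 = `stmt-HodgeConjecture-24832`, h413 = `stmt-HodgeConjecture-24833`) until rung 0 closes.  NOT HERE (by value, per place): the coordinate reading
`conj ψ_S(ι_v n(ι_v b·δ)) = ψ(b ξ)` with `ψ` of conductor `𝒪_v` and `ξ` a unit (★ (d1) `unipDeltaChar_locToAdelic_eq_prod` + ★ B1 `trace_mul_toBlocks₁₂_component_nElem`
+ Tate's local trace letter), the parity letter `hα`, and the good-place letters `|2|_w = |δ|_w = 1`.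

## References
* [HarrisKudlaSweet1996] M. Harris, S. Kudla, W. J. Sweet, J. AMS 9 (1996): §6 (6.14)–(6.16) (`b_1(s,χ) = L(2s+1, χ⁰)`).
* [Casselman1980] W. Casselman, Compositio Math. 40 (1980): §3 Thm. 3.1.   * [Tate1950] J. Tate, thesis (1950): §2.5 (shells, conductor).
* [KudlaRallis1994] S. Kudla, S. Rallis, Ann. of Math. 140 (1994): §2.   * [Shimura1997] G. Shimura, CBMS 93 (1997): §18.1 (18.4), §18.3.
-/

set_option autoImplicit false
-- the mandated namespace repeats the single-problem summit's segment (`HodgeConjecture.HodgeConjecture`)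
set_option linter.dupNamespace false

noncomputable section

open NumberField IsDedekindDomain Matrix MeasureTheory Topology
open scoped ValuativeRel NNReal
open Literature.NumberTheory.GaloisRepresentations.IsNonarchimedeanLocalField
open Literature.NumberTheory.Automorphic Literature.NumberTheory.Automorphic.UnitaryGroup Literature.NumberTheory.Automorphic.LocalFieldHaar
open Literature.NumberTheory.GelbartRogawski1991.AdaptedBlocks
open Literature.NumberTheory.GelbartRogawski1991.UnitaryDualPair.LocalSplitting
open Literature.NumberTheory.K2Lit.LocalSiegelDoubled
open Summit.HodgeConjecture.HodgeConjecture.Cruxes.HLiu418.K2LiuUnipDeltaLocalCoordinates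
open Summit.HodgeConjecture.HodgeConjecture.Cruxes.HLiu418.K2LiuUnipDeltaRankOneCoordinates
open Summit.HodgeConjecture.HodgeConjecture.Cruxes.HLiu418.K2LiuGKRankOneValue
open Summit.HodgeConjecture.HodgeConjecture.Cruxes.HLiu418.K2LiuUnipDeltaRankOneHaar
open Summit.HodgeConjecture.HodgeConjecture.Cruxes.HLiu418.K2LiuGKRankOneIdentityLFactor
open Summit.HodgeConjecture.HodgeConjecture.Cruxes.HLiu418.K2LiuRankOneTwistedWhittakerPolynomial
open Summit.HodgeConjecture.HodgeConjecture.Cruxes.H413.K2E1FiniteWhittakerPolynomial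

namespace Summit.HodgeConjecture.HodgeConjecture.Cruxes.HLiu418.K2LiuKindOneLineGoodPlaceFactor

variable (F : Type) [Field F] [NumberField F] (E : Type) [Field E] [NumberField E] [Algebra F E]
  [Algebra.IsQuadraticExtension F E] (c : E ≃ₐ[F] E) {δ : E} (hcδ : c δ = -δ) (hδ : δ ≠ 0) {d : F} (hd : δ * δ = algebraMap F E d)
  (v : HeightOneSpectrum (𝓞 F)) {T₀ : Matrix (Fin 1) (Fin 1) F} (hT₀ : T₀.IsSymm) (hT₀d : IsUnit T₀.det)
  {JD : Matrix (Fin (1 + 1)) (Fin (1 + 1)) E} (hJD : JD = (gramD F 1 T₀).map (algebraMap F E))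

/-! ## §1 The twisted value in the coordinate `b ↦ n(ι_v b · δ)` -/

section Coordinate

variable [MeasurableSpace (v.adicCompletion F)] [BorelSpace (v.adicCompletion F)]

include hcδ hT₀d hJD in
/-- **THE TWISTED RANK-ONE VALUE IN THE COORDINATE.**  `φ°` spherical in `I_v(s, χ_v)` (★ D10 `IsSphericalSection`), `|2|_w = |δ|_w = 1` and `χ_w` unramified at every
`w ∣ v`, `ϖ` a uniformizer of `F_v`, `t := (∏_{w∣v} χ_w(ι_w ϖ))·(∏_{w∣v} ‖ι_w ϖ‖_w)^{s+½}` with `‖t‖ < q_v⁻¹`; `μ` an additive Haar measure on `F_v`, `ψ` a continuous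
additive character of conductor exponent `0`, `ξ ∈ F_v` a UNIT.  Then the twisted integrand is integrable and
**`∫ φ°(w_Δ · n(ι_v b · δ)) · ψ(b ξ) dμ(b) = μ(𝒪_v) · (1 − t)`** — step weight `1` on `𝒪_v`, `t^{m+1}` on the shell `|b|_v = q_v^{m+1}` (★ profile), and ★ W1-fin-good-II
at conductor `0`, `n = 0` (only the constant term of the polynomial survives for a unit `ξ`).
[cite: HarrisKudlaSweet1996, §6 (6.14)–(6.16)] [cite: Casselman1980, §3 Thm. 3.1] [cite: Tate1950, §2.5] -/
theorem integral_twisted_apply_weylDelta_nElem_coord (μ : Measure (v.adicCompletion F)) [μ.IsAddHaarMeasure]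
    (χv : ∀ w : PlacesOver E v, (w.1.adicCompletion E)ˣ →* ℂˣ) (s : ℂ)
    {φ : UnitaryGroup.localPi E c (1 + 1) JD v → ℂ} (hφ : IsSphericalSection F E c hcδ hδ hd v 1 hT₀ hJD χv s φ)
    (h2 : ∀ w : PlacesOver E v, ValuativeRel.valuation (w.1.adicCompletion E) (2 : w.1.adicCompletion E) = 1)
    (hδw : ∀ w : PlacesOver E v, Valued.v ((δ : E) : w.1.adicCompletion E) = 1)
    (hχ : ∀ (w : PlacesOver E v) (u : (w.1.adicCompletion E)ˣ), Valued.v (u : w.1.adicCompletion E) = 1 → χv w u = 1)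
    {ϖ : v.adicCompletion F} (hϖ : Valued.v ϖ = WithZero.exp (-1 : ℤ)) (hϖ0 : ∀ w : PlacesOver E v, toPlace v w ϖ ≠ 0)
    (ht : ‖(((∏ w : PlacesOver E v, χv w (Units.mk0 (toPlace v w ϖ) (hϖ0 w))) : ℂˣ) : ℂ) *
          (((∏ w : PlacesOver E v, ‖toPlace v w ϖ‖) : ℝ) : ℂ) ^ (s + 1 / 2)‖ < (residueFieldCard (v.adicCompletion F) : ℝ)⁻¹)
    {ψ : AddChar (v.adicCompletion F) Circle} (hψ : Continuous ψ) (h0 : ψ.HasConductorExp 0)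
    {ξ : v.adicCompletion F} (hξ : normAbs (v.adicCompletion F) ξ = 1) :
    Integrable (fun b : v.adicCompletion F => φ (weylDelta F E c v 1 hJD *
        nElem F E c v 1 hJD (Matrix.of fun _ _ : Fin 1 => toLocalRing E v b * algebraMap E (LocalRing E v) δ) (skew_coord F E c hcδ v hT₀d b)) *
          ((ψ (b * ξ) : Circle) : ℂ)) μ ∧
      ∫ b, φ (weylDelta F E c v 1 hJD *
          nElem F E c v 1 hJD (Matrix.of fun _ _ : Fin 1 => toLocalRing E v b * algebraMap E (LocalRing E v) δ) (skew_coord F E c hcδ v hT₀d b)) *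
            ((ψ (b * ξ) : Circle) : ℂ) ∂μ =
        μ.real (primePowBall (v.adicCompletion F) 0) *
          (1 - (((∏ w : PlacesOver E v, χv w (Units.mk0 (toPlace v w ϖ) (hϖ0 w))) : ℂˣ) : ℂ) *
                (((∏ w : PlacesOver E v, ‖toPlace v w ϖ‖) : ℝ) : ℂ) ^ (s + 1 / 2)) := by
  -- the step-weight letters of the profile: `1` on `𝒪_v`, `t^{m+1}` on the shell `|b| = q^{m+1}`
  have hW0 : ∀ b ∈ primePowBall (v.adicCompletion F) 0, φ (weylDelta F E c v 1 hJD *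
      nElem F E c v 1 hJD (Matrix.of fun _ _ : Fin 1 => toLocalRing E v b * algebraMap E (LocalRing E v) δ) (skew_coord F E c hcδ v hT₀d b)) = 1 :=
    fun b hb => apply_weylDelta_mul_nElem_coord_of_le_one F E c hcδ hδ hd v hT₀ hT₀d hJD χv s hφ h2 hδw
      ((mem_primePowBall_zero_iff_valued F v b).1 hb)
  have hWk : ∀ (k : ℕ) (b : v.adicCompletion F), b ∈ primePowBall (v.adicCompletion F) (-((k : ℤ) + 1)) \ primePowBall (v.adicCompletion F) (-(k : ℤ)) →
      φ (weylDelta F E c v 1 hJD *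
        nElem F E c v 1 hJD (Matrix.of fun _ _ : Fin 1 => toLocalRing E v b * algebraMap E (LocalRing E v) δ) (skew_coord F E c hcδ v hT₀d b)) =
        ((((∏ w : PlacesOver E v, χv w (Units.mk0 (toPlace v w ϖ) (hϖ0 w))) : ℂˣ) : ℂ) *
          (((∏ w : PlacesOver E v, ‖toPlace v w ϖ‖) : ℝ) : ℂ) ^ (s + 1 / 2)) ^ (k + 1) := by
    intro k b hb
    have hb' : b ∈ primePowBall (v.adicCompletion F) (-((k : ℤ) + 1)) \ primePowBall (v.adicCompletion F) (-((k : ℤ) + 1) + 1) := by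
      rwa [show (-((k : ℤ) + 1) + 1) = -(k : ℤ) by ring]
    exact localSiegelCharacter_profile F E c hcδ hδ hd v hT₀ hT₀d hJD χv s hφ h2 hδw hχ hϖ hϖ0 k (valued_eq_exp_of_mem_shell F v k hb')
  -- integrability: the untwisted weight is integrable (★ GK engine) and `|ψ| = 1`
  have hWint := (integral_apply_weylDelta_nElem_coord F E c hcδ hδ hd v hT₀ hT₀d hJD μ χv s hφ h2 hδw hχ hϖ hϖ0 ht).1
  have hψc : Continuous fun b : v.adicCompletion F => ((ψ (b * ξ) : Circle) : ℂ) :=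
    continuous_subtype_val.comp (hψ.comp (continuous_id.mul continuous_const))
  have hint : Integrable (fun b : v.adicCompletion F => φ (weylDelta F E c v 1 hJD *
      nElem F E c v 1 hJD (Matrix.of fun _ _ : Fin 1 => toLocalRing E v b * algebraMap E (LocalRing E v) δ) (skew_coord F E c hcδ v hT₀d b)) *
        ((ψ (b * ξ) : Circle) : ℂ)) μ :=
    hWint.mul_bdd hψc.aestronglyMeasurable (Filter.Eventually.of_forall fun b => by rw [Circle.norm_coe])
  refine ⟨hint, ?_⟩
  -- unit `ξ` at conductor `0`: `ξ ∈ 𝔭^{0+0} ∖ 𝔭^{0+0+1}`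
  have hn : ξ ∈ primePowBall (v.adicCompletion F) (0 + ((0 : ℕ) : ℤ)) := by
    rw [mem_primePowBall_iff, hξ, Nat.cast_zero, add_zero, zpow_zero]
  have hn' : ξ ∉ primePowBall (v.adicCompletion F) (0 + ((0 : ℕ) : ℤ) + 1) := by
    rw [mem_primePowBall_iff, hξ, Nat.cast_zero, add_zero, zero_add, zpow_one, not_le]
    exact inv_residueFieldCard_lt_one
  rw [integral_stepWeight_mul_addChar_eq_closedForm_of_integrable μ hψ h0 hn hn' hW0 hWk hint, Finset.sum_range_one, pow_zero, mul_one]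

end Coordinate

/-! ## §2 The `N_Δ`-form: a twist read on the coordinate, any subgroup `N′ = N_Δ(F_v)`, any Haar measure -/

section Unipotent

variable [MeasurableSpace (v.adicCompletion F)] [BorelSpace (v.adicCompletion F)]

include hcδ hT₀d in
/-- **THE TWISTED RANK-ONE GINDIKIN–KARPELEVICH VALUE IN `N_Δ`-FORM.**  For ANY subgroup `N′` of `H(F_v)` EQUAL to ★ D10's `N_Δ(F_v)` (`subst` pattern — the K2Lit
global-comap `unipDeltaLoc v` qualifies by ★ B1 `unipDeltaLoc_eq_unipDeltaLocal`), a Haar measure `ν_N` on `N′`, a spherical section `φ°` of `I_v(s, χ_v)`, the good-place letters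
`|2|_w = |δ|_w = 1`, `χ_w` unramified, a uniformizer `ϖ`, `‖t‖ < q_v⁻¹`, and a twist `Ψ : H(F_v) → ℂ` which on the coordinate READS `Ψ(n(ι_v b · δ)) = ψ(b ξ)` for a continuous
`ψ` of conductor exponent `0` and a unit `ξ` (the reading of `conj ψ_μ ∘ ι_v` by ★ (d1) + ★ B1 + Tate's `hΨ`, by value here):
**`∫_{N′} Ψ(u) · φ°(w_Δ u) dν_N(u) = ν_N(N′ ∩ K_v) · (1 − t)`**.  Proof: ★ `integral_comp_coord` transports to the additive Haar measure `ν_N ∘ ψ⁻¹` on `F_v`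
(★ `isAddHaarMeasure_map_coordInv`), §1 evaluates, ★ `map_coordInv_primePowBall_zero` reads `μ(𝒪_v) = ν_N(N′ ∩ K_v)`.
[cite: HarrisKudlaSweet1996, §6 (6.14)–(6.16)] [cite: Casselman1980, §3 Thm. 3.1] [cite: Shimura1997, §18.1 (18.4)] -/
theorem integral_twist_mul_apply_weylDelta_eq {N' : Subgroup (UnitaryGroup.localPi E c (1 + 1) JD v)} (hN' : N' = unipDeltaLocal F E c v 1 (JD := JD))
    [MeasurableSpace N'] [BorelSpace N'] (νN : Measure N') [νN.IsHaarMeasure]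
    (χv : ∀ w : PlacesOver E v, (w.1.adicCompletion E)ˣ →* ℂˣ) (s : ℂ)
    {φ : UnitaryGroup.localPi E c (1 + 1) JD v → ℂ} (hφ : IsSphericalSection F E c hcδ hδ hd v 1 hT₀ hJD χv s φ)
    (h2 : ∀ w : PlacesOver E v, ValuativeRel.valuation (w.1.adicCompletion E) (2 : w.1.adicCompletion E) = 1)
    (hδw : ∀ w : PlacesOver E v, Valued.v ((δ : E) : w.1.adicCompletion E) = 1)
    (hχ : ∀ (w : PlacesOver E v) (u : (w.1.adicCompletion E)ˣ), Valued.v (u : w.1.adicCompletion E) = 1 → χv w u = 1)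
    {ϖ : v.adicCompletion F} (hϖ : Valued.v ϖ = WithZero.exp (-1 : ℤ)) (hϖ0 : ∀ w : PlacesOver E v, toPlace v w ϖ ≠ 0)
    (ht : ‖(((∏ w : PlacesOver E v, χv w (Units.mk0 (toPlace v w ϖ) (hϖ0 w))) : ℂˣ) : ℂ) *
          (((∏ w : PlacesOver E v, ‖toPlace v w ϖ‖) : ℝ) : ℂ) ^ (s + 1 / 2)‖ < (residueFieldCard (v.adicCompletion F) : ℝ)⁻¹)
    {ψ : AddChar (v.adicCompletion F) Circle} (hψ : Continuous ψ) (h0 : ψ.HasConductorExp 0)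
    {ξ : v.adicCompletion F} (hξ : normAbs (v.adicCompletion F) ξ = 1)
    (Ψ : UnitaryGroup.localPi E c (1 + 1) JD v → ℂ)
    (hΨ : ∀ b : v.adicCompletion F, Ψ (nElem F E c v 1 hJD (Matrix.of fun _ _ : Fin 1 => toLocalRing E v b * algebraMap E (LocalRing E v) δ)
      (skew_coord F E c hcδ v hT₀d b)) = ((ψ (b * ξ) : Circle) : ℂ)) :
    ∫ u, Ψ (u : UnitaryGroup.localPi E c (1 + 1) JD v) * φ (weylDelta F E c v 1 hJD * (u : UnitaryGroup.localPi E c (1 + 1) JD v)) ∂νN =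
      νN.real {u | (u : UnitaryGroup.localPi E c (1 + 1) JD v) ∈ UnitaryGroup.localInt E c (1 + 1) JD v} *
        (1 - (((∏ w : PlacesOver E v, χv w (Units.mk0 (toPlace v w ϖ) (hϖ0 w))) : ℂˣ) : ℂ) *
              (((∏ w : PlacesOver E v, ‖toPlace v w ϖ‖) : ℝ) : ℂ) ^ (s + 1 / 2)) := by
  subst hN'
  rw [integral_comp_coord F E c hcδ hδ v hT₀d hJD νN (fun g => Ψ g * φ (weylDelta F E c v 1 hJD * g))]
  haveI := isAddHaarMeasure_map_coordInv F E c hcδ hδ v hT₀d hJD νN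
  simp only [hΨ]
  have hswap : (fun b : v.adicCompletion F => ((ψ (b * ξ) : Circle) : ℂ) * φ (weylDelta F E c v 1 hJD *
      nElem F E c v 1 hJD (Matrix.of fun _ _ : Fin 1 => toLocalRing E v b * algebraMap E (LocalRing E v) δ) (skew_coord F E c hcδ v hT₀d b))) =
      fun b => φ (weylDelta F E c v 1 hJD *
        nElem F E c v 1 hJD (Matrix.of fun _ _ : Fin 1 => toLocalRing E v b * algebraMap E (LocalRing E v) δ) (skew_coord F E c hcδ v hT₀d b)) *
          ((ψ (b * ξ) : Circle) : ℂ) := funext fun b => mul_comm _ _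
  rw [hswap, (integral_twisted_apply_weylDelta_nElem_coord F E c hcδ hδ hd v hT₀ hT₀d hJD _ χv s hφ h2 hδw hχ hϖ hϖ0 ht hψ h0 hξ).2, measureReal_def,
    map_coordInv_primePowBall_zero F E c hcδ hδ v hT₀d hJD νN h2 hδw, ← measureReal_def]

/-- **THE SAME WITH THE RAW PARAMETER READ** (`0 < re s`, `|α| ≤ 1` — e.g. `χ_w` unitary): `t = α · q_v^{−(2s+1)}` (★ `prod_norm_toPlace_cpow`), `‖t‖ < q_v⁻¹`
(★ `norm_rawParam_lt_of_re_pos`), and under the normalisation `ν_N(N′ ∩ K_v) = 1` of ★ Φ3c's `hνK`: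
**`∫_{N′} Ψ(u) · φ°(w_Δ u) dν_N(u) = 1 − α · q_v^{−(2s+1)}`**, `α = ∏_{w∣v} χ_w(ι_w ϖ)` — the right-hand side of `hJ₁` up to the parity letter `α = ε(ϖ_v)`.
[cite: HarrisKudlaSweet1996, §6 (6.16)] [cite: Tate1950, §2.5] -/
theorem integral_twist_mul_apply_weylDelta_eq_of_re_pos {N' : Subgroup (UnitaryGroup.localPi E c (1 + 1) JD v)} (hN' : N' = unipDeltaLocal F E c v 1 (JD := JD))
    [MeasurableSpace N'] [BorelSpace N'] (νN : Measure N') [νN.IsHaarMeasure]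
    (hvol : νN.real {u | (u : UnitaryGroup.localPi E c (1 + 1) JD v) ∈ UnitaryGroup.localInt E c (1 + 1) JD v} = 1)
    (χv : ∀ w : PlacesOver E v, (w.1.adicCompletion E)ˣ →* ℂˣ) {s : ℂ} (hs : 0 < s.re)
    {φ : UnitaryGroup.localPi E c (1 + 1) JD v → ℂ} (hφ : IsSphericalSection F E c hcδ hδ hd v 1 hT₀ hJD χv s φ)
    (h2 : ∀ w : PlacesOver E v, ValuativeRel.valuation (w.1.adicCompletion E) (2 : w.1.adicCompletion E) = 1)
    (hδw : ∀ w : PlacesOver E v, Valued.v ((δ : E) : w.1.adicCompletion E) = 1)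
    (hχ : ∀ (w : PlacesOver E v) (u : (w.1.adicCompletion E)ˣ), Valued.v (u : w.1.adicCompletion E) = 1 → χv w u = 1)
    {ϖ : v.adicCompletion F} (hϖ : Valued.v ϖ = WithZero.exp (-1 : ℤ)) (hϖ0 : ∀ w : PlacesOver E v, toPlace v w ϖ ≠ 0)
    (hα : ‖(((∏ w : PlacesOver E v, χv w (Units.mk0 (toPlace v w ϖ) (hϖ0 w))) : ℂˣ) : ℂ)‖ ≤ 1)
    {ψ : AddChar (v.adicCompletion F) Circle} (hψ : Continuous ψ) (h0 : ψ.HasConductorExp 0)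
    {ξ : v.adicCompletion F} (hξ : normAbs (v.adicCompletion F) ξ = 1)
    (Ψ : UnitaryGroup.localPi E c (1 + 1) JD v → ℂ)
    (hΨ : ∀ b : v.adicCompletion F, Ψ (nElem F E c v 1 hJD (Matrix.of fun _ _ : Fin 1 => toLocalRing E v b * algebraMap E (LocalRing E v) δ)
      (skew_coord F E c hcδ v hT₀d b)) = ((ψ (b * ξ) : Circle) : ℂ)) :
    ∫ u, Ψ (u : UnitaryGroup.localPi E c (1 + 1) JD v) * φ (weylDelta F E c v 1 hJD * (u : UnitaryGroup.localPi E c (1 + 1) JD v)) ∂νN =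
      1 - (((∏ w : PlacesOver E v, χv w (Units.mk0 (toPlace v w ϖ) (hϖ0 w))) : ℂˣ) : ℂ) *
        (residueFieldCard (v.adicCompletion F) : ℂ) ^ (-(2 * s + 1)) := by
  rw [integral_twist_mul_apply_weylDelta_eq F E c hcδ hδ hd v hT₀ hT₀d hJD hN' νN χv s hφ h2 hδw hχ hϖ hϖ0
    (norm_rawParam_lt_of_re_pos F E v χv hϖ hϖ0 hs hα) hψ h0 hξ Ψ hΨ, hvol, prod_norm_toPlace_cpow F E v hϖ s]
  push_cast
  ring

end Unipotent

end Summit.HodgeConjecture.HodgeConjecture.Cruxes.HLiu418.K2LiuKindOneLineGoodPlaceFactor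

/-! ## §3 The K2Lit CM datum: the `hJ₁` letter of ★ (KW1-b) `whittakerDelta_eq_kindWPart_mul_line`, in its own currency -/

namespace Summit.HodgeConjecture.HodgeConjecture.Cruxes.HLiu418.K2LiuKindOneLineGoodPlaceFactor

section CM

open scoped ComplexConjugate
open Literature.NumberTheory.GaloisRepresentations
open Literature.NumberTheory.GelbartRogawski1991 Literature.NumberTheory.GelbartRogawski1991.GRConstruction
open Literature.NumberTheory.GelbartRogawski1991.UnitaryDualPair
open Literature.NumberTheory.K2Lit Literature.NumberTheory.K2Lit.SiegelDoubled
open Summit.HodgeConjecture.HodgeConjecture.Cruxes.HLiu418.K2LiuSiegelUnipotentFourierDefs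
open Summit.HodgeConjecture.HodgeConjecture.Cruxes.HLiu418.K2LiuSiegelUnipotentLocalDefs
open Summit.HodgeConjecture.HodgeConjecture.Cruxes.HLiu418.K2LiuUnipDeltaLocBridge
open Summit.HodgeConjecture.HodgeConjecture.Cruxes.HLiu418.K2LiuSphericalSectionLambdaLoc
open Summit.HodgeConjecture.HodgeConjecture.Cruxes.HLiu418.K2LiuLocalWhittakerFactorSkew

variable (L : Type) [Field L] [NumberField L] [IsCMField L]
variable {N M : ℕ} (e : Fin N × Fin M ≃ Fin 1)
  (dV : Fin N → L) (hdV : ∀ i, IsCMField.complexConj L (dV i) = dV i) (hdV0 : ∀ i, dV i ≠ 0)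
  (dW : Fin M → L) (hdW : ∀ i, IsCMField.complexConj L (dW i) = dW i) (hdW0 : ∀ i, dW i ≠ 0)
  (v : HeightOneSpectrum (𝓞 (Fp L)))
  [MeasurableSpace (v.adicCompletion (Fp L))] [BorelSpace (v.adicCompletion (Fp L))]
  [MeasurableSpace ↥(unipDeltaLoc L e dV hdV dW hdW v)] [BorelSpace ↥(unipDeltaLoc L e dV hdV dW hdW v)]

omit [IsCMField L] [MeasurableSpace (HeightOneSpectrum.adicCompletion (Fp L) v)] [BorelSpace (HeightOneSpectrum.adicCompletion (Fp L) v)] in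
/-- an unramified `χ_w` is trivial on the `w`-units, in the `Valued.v` currency of the rank-one GK letters (★ `IsUnramifiedAt.localComponent_eq_one_of_valuation_eq_one`,
★ `valuation_eq_one_iff_valued`). [cite: Casselman1980, §3] -/
theorem localComponent_eq_one_of_valued_eq_one {χ : HeckeCharacter L} (hχ : ∀ w : UnitaryGroup.PlacesOver L v, χ.IsUnramifiedAt w.1)
    (w : UnitaryGroup.PlacesOver L v) (u : (w.1.adicCompletion L)ˣ) (hu : Valued.v (u : w.1.adicCompletion L) = 1) :
    χ.localComponent w.1 u = 1 :=
  (hχ w).localComponent_eq_one_of_valuation_eq_one ((LocalSplitting.valuation_eq_one_iff_valued L w.1 (u : w.1.adicCompletion L)).2 hu)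

include hdV0 hdW0 in
set_option maxHeartbeats 800000 in -- MEASURED (as ★ p862675 §2 ∕ ★ G1, whose binder telescope this statement repeats: default 200 000 times out at `whnf` of the statement); plain `rw`∕`exact`, no search tactics
/-- **THE `hJ₁` LETTER OF ★ (KW1-b) AT A GOOD PLACE, PAID** (doubled LINE datum `e : Fin N × Fin M ≃ Fin 1`, K2Lit CM frame; ★ p862675's binder :154–163 in its own tokens):
for `χ` unramified above `v`, `0 < re s`, the good-place letters `|2|_w = |δ|_w = 1`, a uniformizer `ϖ` of `L⁺_v`, the parity letter
`∏_{w∣v} χ_w(ι_w ϖ) = ε_{L∕L⁺}(ϖ_v)` (★ `K2LiuGoodPlaceLocalFactor`'s `hα`, by value), a Haar measure `ν` on `N_Δ(L⁺_v) = unipDeltaLoc v` normalised by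
`ν(N_Δ ∩ K_{H,v}) = 1` (★ Φ3c's `hνK`), and the COORDINATE READING of the character `conj ψ_μ(ι_v n(ι_v b·δ)) = ψ(b ξ)` for a continuous `ψ` of conductor `𝒪_v`
and a unit `ξ` (by value; ★ (d1) + ★ B1 `trace_mul_toBlocks₁₂_component_nElem` + Tate's local trace letter pay it):
**`∫ conj ψ_μ(ι_v y) · Λ_{s,v}((w_Δ)_v · y) dν(y) = 1 − ε(ϖ_v) · q_v^{−(2s+1)}`**, `q_v = v.residueCard`.
PROOF: ★ B4 §1 `evalPlace_finPart_weylDelta` (`(w_Δ)_v` = ★ D10's local `w_Δ`), ★ B1 `unipDeltaLoc_eq_unipDeltaLocal`, ★ (4c) `isSphericalSection_lambdaLoc`, and §2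
`integral_twist_mul_apply_weylDelta_eq_of_re_pos`; then `α = ε(ϖ_v)` and ★ `residueFieldCard_adicCompletion_eq`.
[cite: HarrisKudlaSweet1996, §6 (6.16)] [cite: Casselman1980, §3 Thm. 3.1] [cite: Tate1950, §2.5] [cite: Shimura1997, §18.1 (18.4)] -/
theorem integral_conj_unipDeltaChar_mul_lambdaLoc_weylDelta_eq (ν : Measure ↥(unipDeltaLoc L e dV hdV dW hdW v)) [ν.IsHaarMeasure]
    (hvol : ν.real {u | (u : UnitaryGroup.localPi L (IsCMField.complexConj L) (1 + 1) (hermD L e dV hdV dW hdW) v) ∈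
      UnitaryGroup.localInt L (IsCMField.complexConj L) (1 + 1) (hermD L e dV hdV dW hdW) v} = 1)
    {χ : HeckeCharacter L} (hχ : ∀ w : UnitaryGroup.PlacesOver L v, χ.IsUnramifiedAt w.1) {s : ℂ} (hs : 0 < s.re)
    (h2 : ∀ w : UnitaryGroup.PlacesOver L v, ValuativeRel.valuation (w.1.adicCompletion L) (2 : w.1.adicCompletion L) = 1)
    (hδw : ∀ w : UnitaryGroup.PlacesOver L v, Valued.v ((imagUnit L : L) : w.1.adicCompletion L) = 1)
    {ϖ : v.adicCompletion (Fp L)} (hϖ : Valued.v ϖ = WithZero.exp (-1 : ℤ)) (hϖ0 : ∀ w : UnitaryGroup.PlacesOver L v, toPlace v w ϖ ≠ 0)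
    (hα : (((∏ w : UnitaryGroup.PlacesOver L v, χ.localComponent w.1 (Units.mk0 (toPlace v w ϖ) (hϖ0 w))) : ℂˣ) : ℂ) =
      (quadraticHeckeCharCM L).valueAtUniformizer v)
    {ψ : AddChar (v.adicCompletion (Fp L)) Circle} (hψ : Continuous ψ) (h0 : ψ.HasConductorExp 0)
    {ξ : v.adicCompletion (Fp L)} (hξ : normAbs (v.adicCompletion (Fp L)) ξ = 1)
    (S : Matrix (Fin 1) (Fin 1) L)
    (hread : haveI : Algebra.IsQuadraticExtension (Fp L) L := IsCMField.isQuadraticExtension L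
      ∀ b : v.adicCompletion (Fp L),
        conj ((unipDeltaChar L e dV hdV dW hdW S (locToAdelic L e dV hdV dW hdW v
          (nElem (Fp L) L (IsCMField.complexConj L) v 1 (hermD_eq_map_gramD L e dV hdV dW hdW)
            (Matrix.of fun _ _ : Fin 1 => toLocalRing L v b * algebraMap L (LocalRing L v) (imagUnit L))
            (skew_coord (Fp L) L (IsCMField.complexConj L) (complexConj_imagUnit L) v (isUnit_det_gramR₀ L e dV hdV hdV0 dW hdW hdW0) b))) : Circle) : ℂ) =
          ((ψ (b * ξ) : Circle) : ℂ)) :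
    ∫ y, conj ((unipDeltaChar L e dV hdV dW hdW S (locToAdelic L e dV hdV dW hdW v
        (y : UnitaryGroup.localPi L (IsCMField.complexConj L) (1 + 1) (hermD L e dV hdV dW hdW) v)) : Circle) : ℂ) *
      LambdaLoc L e dV hdV dW hdW v χ s
        (UnitaryGroup.evalPlace (Fp L) L (IsCMField.complexConj L) (1 + 1) (hermD L e dV hdV dW hdW) v
            (UnitaryGroup.finPart (Fp L) L (IsCMField.complexConj L) (1 + 1) (hermD L e dV hdV dW hdW) (SiegelDoubled.weylDelta L e dV hdV dW hdW)) *
          (y : UnitaryGroup.localPi L (IsCMField.complexConj L) (1 + 1) (hermD L e dV hdV dW hdW) v)) ∂ν =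
      1 - (quadraticHeckeCharCM L).valueAtUniformizer v * (v.residueCard : ℂ) ^ (-(2 * s + 1)) := by
  haveI : Algebra.IsQuadraticExtension (Fp L) L := IsCMField.isQuadraticExtension L
  have hα_le : ‖(((∏ w : UnitaryGroup.PlacesOver L v, χ.localComponent w.1 (Units.mk0 (toPlace v w ϖ) (hϖ0 w))) : ℂˣ) : ℂ)‖ ≤ 1 := by
    rw [hα]
    exact (HeckeCharacter.norm_valueAtUniformizer_of_isUnitary
      (Literature.RepresentationTheory.HarrisKudlaSweet1996.isFiniteOrder_quadraticHeckeCharCM (L := L)).isUnitary v).le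
  simp only [evalPlace_finPart_weylDelta]
  have key := integral_twist_mul_apply_weylDelta_eq_of_re_pos (Fp L) L (IsCMField.complexConj L) (complexConj_imagUnit L) (imagUnit_ne_zero L)
    (imagUnit_mul_self L) v (gramR_isSymm L e dV hdV dW hdW) (isUnit_det_gramR₀ L e dV hdV hdV0 dW hdW hdW0) (hermD_eq_map_gramD L e dV hdV dW hdW)
    (unipDeltaLoc_eq_unipDeltaLocal L e dV hdV dW hdW v) ν hvol (fun w => χ.localComponent w.1) hs
    (isSphericalSection_lambdaLoc L e dV hdV dW hdW v χ s hχ) h2 hδw (localComponent_eq_one_of_valued_eq_one L v hχ) hϖ hϖ0 hα_le hψ h0 hξ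
    (fun y => conj ((unipDeltaChar L e dV hdV dW hdW S (locToAdelic L e dV hdV dW hdW v y) : Circle) : ℂ)) hread
  rw [key, hα, Literature.NumberTheory.Automorphic.residueFieldCard_adicCompletion_eq]

end CM

end Summit.HodgeConjecture.HodgeConjecture.Cruxes.HLiu418.K2LiuKindOneLineGoodPlaceFactor

end
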